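import Summits.QuantumFields.YangMills.Theorems.BalabanUVNodesK0RecordFormatNamesLemmas15

/-!
# NODE O · K0ᴬ — PART B-1 of ★★★ №541 (R-a) «move the chart, not the letters»: THE JOINT GAUGE-FLOW MAP `Φ(λ, w) := gaugeFlowMap F K (expGauge F K λ 1) w` AND THE
# GENERIC DRESSED-CHART ROWS (linearisation ∕ smoothness ∕ value ∕ swap)

LANDING NOTE (porter ▶ PTC-1 g4, 2026-08-31; AUTHORSHIP = ◇ lens-1 g10 «cauchy-analytic», HOME sketch `nodeO-cover/LENS-1g10-Rb-1-GaugeFlowRecDressed.lean` sha16 1031c57217901b9f · 300 l. · 14 thm · 0 def · 0 sorry):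
landed VERBATIM (only this paragraph added) under the basename ◇ lens-1 proposed, on ★★★ director-ym №541 (R-a) ∕ №544 (c) («then PART B pieces») and ◆ CRIT-1 g36's cut of PART B: PASS ×3 — GO to
land in order B-1 → B-2 → B-3, basenames as proposed; standing (Q-ord) check PASS; J5′ census 0 HIT; J1′ junk canaries excluded; axioms standard on ◆'s own runs (nodeO STATUS
2026-08-31T09:48:32Z);
helper `--supports stmt-QuantumFields-27238 --as helper` (NO `--workitem`).  PART B-1 of three (B-1 → B-2 `…K0RecordFormatNamesDressedRows` → B-3 `…K0AxJoinTDressed`).  HONEST (porter): calculus ∕ bookkeeping ∕ CONDITIONAL assembly over DISPLAYED rows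
(D1 = ⟨27930⟩'s ⁸ consequent, `DressLink` ⟸ (C-orb) `RootedResponseOrbitAt` mod P0, HypAn, (Tok-cmpU-cap) — all OPEN, asserted nowhere); [E] inhabited unconditionally NOWHERE; nothing of
Bałaban asserted, ported, discharged or refuted; K0ᴬ stmt-QuantumFields-27238 OPEN — NOTHING of it proved; NODE O 0∕1; COUNT 8∕28 · K 1∕4 UNMOVED; finite 𝕋⁴ at fixed ε — NOT continuum ∕ OS ∕ Clay;
the Yang–Mills mass gap is NOT proved by any of this.

◇ `ymgap-nodeO-lens-1` g10 (planner; typed for the porter ▶ PTC-1 g4; proposed target `Summits/QuantumFields/YangMills/Theorems/BalabanUVNodesK0AxGaugeFlowRecDressed.lean`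
`--supports stmt-QuantumFields-27238 --as helper`).  Items: K0ᴬ `Record13SepCoPHInhabitedAx` (stmt-QuantumFields-27238) OPEN; K0⁷ 20541 OPEN.

(A1) `gaugeGen` is ℂ-linear in `λ` (a CLM); `expGauge F K (t • μ) 1 = expGauge F K μ t`; at the origin every transformed `𝐔`-block is the unit;
(A2) ★ `Φ` is JOINTLY ANALYTIC (over ℂ, in `(λ, w)`) wherever the transformed `𝐔`-blocks are inside the `log`-ball (mirror of ✓`analyticAt_gaugeFlowMap` with the generator varying);
(A3) `Φ(0, w) = w` on the `log`-window; (A4) ★★ `DΦ(0,0)(μ, v) = recordGradLeg μ + v` (generator slot by the real curve `t ↦ t•(μ,0)` + ✓`hasDerivAt_gaugeFlowMap_expGauge`;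
chart slot because `Φ(0,·) = id` near `0`); (A5) for ANY ℝ-linear `lamOf : E →L[ℝ] (sites → ℂ³)` and ANY chart `ι : E → ℂ^{dimJ}` with `ι 0 = 0`, the dressed chart
`B ↦ Φ(lamOf B, ι B)` has `fderiv … 0 v = recordGradLeg (lamOf v) + Dι(0) v`, inherits `ContDiffAt ℝ n` from `ι`, vanishes at `0`, and satisfies the SWAP ROW near `0`
(`χ_X(Φ(lamOf B, ι B)) = (χ_X(ι B))^{g_B}`, `g_B := expGauge (lamOf B) 1`, by ✓`recordChartJ_gaugeFlowMap` + continuity).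
HONEST: calculus ∕ bookkeeping over the tree's gauge-flow API only; no record letter, no Bałaban estimate; [E] inhabited unconditionally NOWHERE; nothing of Bałaban ([I] Thm 1,
(1.18)–(1.22), (4.35)–(4.37); [15] Prop. 9; [B6] (2.35)) asserted, ported or discharged; K0ᴬ 27238 ∕ K0⁷ 20541 OPEN; NODE O 0∕1; COUNT 8∕28 · K 1∕4 UNMOVED; finite `𝕋⁴_{L^K}` at
fixed ε — NOT continuum ∕ OS ∕ Clay; **the Yang–Mills mass gap is NOT proved.**  No `instance ∕ notation ∕ allowUnsafeReducibility`; 0 sorry; standard axioms.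
-/

noncomputable section

open scoped BigOperators Matrix.Norms.L2Operator Topology
open Set Filter Metric
open NormedSpace (exp)

/-! ## §A  The joint flow map `Φ(λ, w) = gaugeFlowMap F K (expGauge F K λ 1) w` -/

namespace Summit.QuantumFields.YangMills.Theorems.K0AxGaugeFlowRec

open Summit.QuantumFields.YangMills.Theorems.K0RecordFormatNames
open Summit.QuantumFields.YangMills.Theorems
open Literature.MathematicalPhysics.QuantumFieldTheory.Balaban1983to89
open Literature.MathematicalPhysics.QuantumFieldTheory.Balaban1983to89.Node00
open Literature.MathematicalPhysics.QuantumFieldTheory.Balaban1983to89.T4Continuum (T4Family)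

variable (F : T4Family)

/-- (A1) The gauge generator at a site is a continuous ℂ-linear function of the potential `λ`. [cite: Balaban1987RG1, (1.10) p.262 (bookkeeping)] -/
theorem exists_gaugeGenCLM (K : ℕ) (x : Site (F.P K) 0) :
    ∃ L : (Site (F.P K) 0 → Fin 3 → ℂ) →L[ℂ] MatA 2, ∀ lam, L lam = gaugeGen F K lam x :=
  ⟨LinearMap.toContinuousLinearMap
    { toFun := fun lam => gaugeGen F K lam x
      map_add' := fun lam lam' => by simp [gaugeGen, add_smul, Finset.sum_add_distrib]
      map_smul' := fun c lam => by simp [gaugeGen, Finset.smul_sum, smul_smul] }, fun _ => rfl⟩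

/-- (A1) Time-`1` flow of `t•μ` = time-`t` flow of `μ`. [cite: Balaban1987RG1, (4.8) p.283 (bookkeeping)] -/
theorem expGauge_smul_one (K : ℕ) (μ : Site (F.P K) 0 → Fin 3 → ℂ) (t : ℝ) : expGauge F K (t • μ) 1 = expGauge F K μ t := by
  apply Subtype.ext
  funext x
  apply Units.ext
  rw [coe_expGauge, coe_expGauge]
  congr 1
  simp only [gaugeGen, Pi.smul_apply, Complex.real_smul, Complex.ofReal_one, one_mul, Finset.smul_sum, smul_smul]

/-- (A1) At the origin `(λ, w) = (0, 0)` every transformed `𝐔`-block is the unit. [cite: Balaban1987RG1, (4.8) p.283 (bookkeeping)] -/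
theorem actU_expGauge_zeroPot_zero (K : ℕ) (b : PBond (F.P K) 0) : actU F K (expGauge F K 0 1) 0 b = 1 := by
  rw [expGauge_zeroPot F K 1 0]
  simp [actU]

/-- (A2) ★ **The joint flow map `(λ, w) ↦ φ_{exp Λ_λ}(w)` is ANALYTIC** (jointly, over `ℂ`) wherever the transformed `𝐔`-blocks are inside the `log`-ball.
[cite: Balaban1987RG1, (4.8) p.283 (analyticity of the flow in the chart and in the generator), (1.10) p.262] -/
theorem analyticAt_gaugeFlowMap₂ (K : ℕ) (p₀ : (Site (F.P K) 0 → Fin 3 → ℂ) × (Fin (recordChartDimJ F K) → ℂ))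
    (h : ∀ b : PBond (F.P K) 0, ‖actU F K (expGauge F K p₀.1 1) p₀.2 b - 1‖ < 1) :
    AnalyticAt ℂ (fun p : (Site (F.P K) 0 → Fin 3 → ℂ) × (Fin (recordChartDimJ F K) → ℂ) => gaugeFlowMap F K (expGauge F K p.1 1) p.2) p₀ := by
  have hG : ∀ x : Site (F.P K) 0,
      AnalyticAt ℂ (fun p : (Site (F.P K) 0 → Fin 3 → ℂ) × (Fin (recordChartDimJ F K) → ℂ) => gaugeGen F K p.1 x) p₀ := by
    intro x
    obtain ⟨L, hL⟩ := exists_gaugeGenCLM F K x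
    exact ((L.comp (ContinuousLinearMap.fst ℂ _ _)).analyticAt p₀).congr (Eventually.of_forall fun p => by simp [hL])
  have hE : ∀ x : Site (F.P K) 0,
      AnalyticAt ℂ (fun p : (Site (F.P K) 0 → Fin 3 → ℂ) × (Fin (recordChartDimJ F K) → ℂ) => (((expGauge F K p.1 1).1 x : (MatA 2)ˣ) : MatA 2)) p₀ := by
    intro x
    simp only [coe_expGauge, Complex.ofReal_one, one_smul]
    exact AnalyticAt.comp (f := fun p : (Site (F.P K) 0 → Fin 3 → ℂ) × (Fin (recordChartDimJ F K) → ℂ) => gaugeGen F K p.1 x) (x := p₀)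
      (NormedSpace.exp_analytic (𝕂 := ℂ) _) (hG x)
  have hEi : ∀ x : Site (F.P K) 0,
      AnalyticAt ℂ (fun p : (Site (F.P K) 0 → Fin 3 → ℂ) × (Fin (recordChartDimJ F K) → ℂ) => ((((expGauge F K p.1 1).1 x)⁻¹ : (MatA 2)ˣ) : MatA 2)) p₀ := by
    intro x
    simp only [coe_inv_expGauge, Complex.ofReal_one, one_smul]
    have hGn : AnalyticAt ℂ (fun p : (Site (F.P K) 0 → Fin 3 → ℂ) × (Fin (recordChartDimJ F K) → ℂ) => -gaugeGen F K p.1 x) p₀ := (hG x).neg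
    exact AnalyticAt.comp (f := fun p : (Site (F.P K) 0 → Fin 3 → ℂ) × (Fin (recordChartDimJ F K) → ℂ) => -gaugeGen F K p.1 x) (x := p₀)
      (NormedSpace.exp_analytic (𝕂 := ℂ) _) hGn
  have hU : ∀ b : PBond (F.P K) 0,
      AnalyticAt ℂ (fun p : (Site (F.P K) 0 → Fin 3 → ℂ) × (Fin (recordChartDimJ F K) → ℂ) => exp (chartMatU F K p.2 b)) p₀ := by
    intro b
    have h1 : AnalyticAt ℂ (fun p : (Site (F.P K) 0 → Fin 3 → ℂ) × (Fin (recordChartDimJ F K) → ℂ) => chartMatU F K p.2 b) p₀ :=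
      (((LinearMap.toContinuousLinearMap (chartMatULM F K b)).comp (ContinuousLinearMap.snd ℂ _ _)).analyticAt p₀).congr
        (Eventually.of_forall fun p => rfl)
    exact AnalyticAt.comp (f := fun p : (Site (F.P K) 0 → Fin 3 → ℂ) × (Fin (recordChartDimJ F K) → ℂ) => chartMatU F K p.2 b) (x := p₀)
      (NormedSpace.exp_analytic (𝕂 := ℂ) _) h1
  have hact : ∀ b : PBond (F.P K) 0,
      AnalyticAt ℂ (fun p : (Site (F.P K) 0 → Fin 3 → ℂ) × (Fin (recordChartDimJ F K) → ℂ) => actU F K (expGauge F K p.1 1) p.2 b) p₀ :=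
    fun b => ((hE b.src).mul (hU b)).mul (hEi b.tgt)
  have hcoord : ∀ i, AnalyticAt ℂ (fun p : (Site (F.P K) 0 → Fin 3 → ℂ) × (Fin (recordChartDimJ F K) → ℂ) => gaugeFlowMap F K (expGauge F K p.1 1) p.2 i) p₀ := by
    intro i
    rcases hc : ((chartEquivJ F K).symm i).2 with a | a
    · obtain ⟨L, hL⟩ := exists_sl2CoordCLM a
      have hlog : AnalyticAt ℂ (MatrixLog.mlog : MatA 2 → MatA 2) (actU F K (expGauge F K p₀.1 1) p₀.2 ((chartEquivJ F K).symm i).1) :=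
        MatrixLog.analyticAt_mlog (h _)
      have hin : AnalyticAt ℂ (fun p : (Site (F.P K) 0 → Fin 3 → ℂ) × (Fin (recordChartDimJ F K) → ℂ) =>
          MatrixLog.mlog (actU F K (expGauge F K p.1 1) p.2 ((chartEquivJ F K).symm i).1)) p₀ :=
        AnalyticAt.comp (g := MatrixLog.mlog)
          (f := fun p : (Site (F.P K) 0 → Fin 3 → ℂ) × (Fin (recordChartDimJ F K) → ℂ) => actU F K (expGauge F K p.1 1) p.2 ((chartEquivJ F K).symm i).1)
          (x := p₀) hlog (hact _)
      have hcomp : AnalyticAt ℂ (fun p : (Site (F.P K) 0 → Fin 3 → ℂ) × (Fin (recordChartDimJ F K) → ℂ) =>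
          L (MatrixLog.mlog (actU F K (expGauge F K p.1 1) p.2 ((chartEquivJ F K).symm i).1))) p₀ :=
        AnalyticAt.comp (g := fun A => L A)
          (f := fun p : (Site (F.P K) 0 → Fin 3 → ℂ) × (Fin (recordChartDimJ F K) → ℂ) => MatrixLog.mlog (actU F K (expGauge F K p.1 1) p.2 ((chartEquivJ F K).symm i).1))
          (x := p₀) (L.analyticAt _) hin
      refine hcomp.congr (Eventually.of_forall fun p => ?_)
      simp only [hL, gaugeFlowMap, pairCoordsJ, hc, Sum.elim_inl]
      rfl
    · obtain ⟨L, hL⟩ := exists_sl2CoordCLM a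
      have hJc : AnalyticAt ℂ (fun p : (Site (F.P K) 0 → Fin 3 → ℂ) × (Fin (recordChartDimJ F K) → ℂ) => chartMatJc F K p.2 ((chartEquivJ F K).symm i).1) p₀ :=
        (((LinearMap.toContinuousLinearMap (chartMatJcLM F K ((chartEquivJ F K).symm i).1)).comp (ContinuousLinearMap.snd ℂ _ _)).analyticAt p₀).congr
          (Eventually.of_forall fun p => rfl)
      have hJ : AnalyticAt ℂ (fun p : (Site (F.P K) 0 → Fin 3 → ℂ) × (Fin (recordChartDimJ F K) → ℂ) =>
          ((expGauge F K p.1 1).1 ((chartEquivJ F K).symm i).1.src : MatA 2) * chartMatJc F K p.2 ((chartEquivJ F K).symm i).1 *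
            (((expGauge F K p.1 1).1 ((chartEquivJ F K).symm i).1.src)⁻¹ : (MatA 2)ˣ)) p₀ :=
        ((hE _).mul hJc).mul (hEi _)
      have hcomp : AnalyticAt ℂ (fun p : (Site (F.P K) 0 → Fin 3 → ℂ) × (Fin (recordChartDimJ F K) → ℂ) =>
          L (((expGauge F K p.1 1).1 ((chartEquivJ F K).symm i).1.src : MatA 2) * chartMatJc F K p.2 ((chartEquivJ F K).symm i).1 *
            (((expGauge F K p.1 1).1 ((chartEquivJ F K).symm i).1.src)⁻¹ : (MatA 2)ˣ))) p₀ :=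
        AnalyticAt.comp (g := fun A => L A) (x := p₀) (L.analyticAt _) hJ
      refine hcomp.congr (Eventually.of_forall fun p => ?_)
      simp only [hL, gaugeFlowMap, pairCoordsJ, hc, Sum.elim_inr]
      rfl
  exact AnalyticAt.pi (f := fun i (p : (Site (F.P K) 0 → Fin 3 → ℂ) × (Fin (recordChartDimJ F K) → ℂ)) => gaugeFlowMap F K (expGauge F K p.1 1) p.2 i) hcoord

/-- (A2) The joint flow map is analytic at the origin. [cite: Balaban1987RG1, (4.8) p.283 (bookkeeping)] -/
theorem analyticAt_gaugeFlowMap₂_zero (K : ℕ) :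
    AnalyticAt ℂ (fun p : (Site (F.P K) 0 → Fin 3 → ℂ) × (Fin (recordChartDimJ F K) → ℂ) => gaugeFlowMap F K (expGauge F K p.1 1) p.2) 0 :=
  analyticAt_gaugeFlowMap₂ F K 0 fun b => by
    rw [Prod.fst_zero, Prod.snd_zero, actU_expGauge_zeroPot_zero, sub_self, norm_zero]; exact one_pos

/-- (A3) `Φ(0, w) = w` on the `log`-window (`exp(0) = 1`, `log e^{A} = A`). [cite: Balaban1987RG1, (4.8) p.283, (1.10) p.262 (bookkeeping)] -/
theorem gaugeFlowMap_expGauge_zeroPot_self (K : ℕ) (w : Fin (recordChartDimJ F K) → ℂ) (hA : ∀ b : PBond (F.P K) 0, ‖chartMatU F K w b‖ < Real.log 2) :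
    gaugeFlowMap F K (expGauge F K 0 1) w = w := by
  have h1 : ∀ x : Site (F.P K) 0, (((expGauge F K 0 1).1 x : (MatA 2)ˣ) : MatA 2) = 1 ∧ ((((expGauge F K 0 1).1 x)⁻¹ : (MatA 2)ˣ) : MatA 2) = 1 :=
    fun x => by rw [expGauge_zeroPot F K 1 0]; exact expGauge_zero_apply F K 0 x
  funext i
  have hp : ∀ s : Fin 3 ⊕ Fin 3, (chartEquivJ F K).symm i = (((chartEquivJ F K).symm i).1, s) → i = chartEquivJ F K (((chartEquivJ F K).symm i).1, s) :=
    fun s hs => by rw [← hs, Equiv.apply_symm_apply]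
  rcases hc : ((chartEquivJ F K).symm i).2 with a | a
  · have : gaugeFlowMap F K (expGauge F K 0 1) w i = sl2Coord (MatrixLog.mlog (actU F K (expGauge F K 0 1) w ((chartEquivJ F K).symm i).1)) a := by
      simp only [gaugeFlowMap, pairCoordsJ, hc, Sum.elim_inl]; rfl
    rw [this, actU, (h1 _).1, (h1 _).2, one_mul, mul_one, B7BlockAvgLog.mlog_exp (hA _), BalabanUVNodesPortS1.sl2Coord_chartMatU]
    exact congrArg w (hp (Sum.inl a) (Prod.ext rfl hc)).symm
  · have : gaugeFlowMap F K (expGauge F K 0 1) w i = sl2Coord (((expGauge F K 0 1).1 ((chartEquivJ F K).symm i).1.src : MatA 2) *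
        chartMatJc F K w ((chartEquivJ F K).symm i).1 * (((expGauge F K 0 1).1 ((chartEquivJ F K).symm i).1.src)⁻¹ : (MatA 2)ˣ)) a := by
      simp only [gaugeFlowMap, pairCoordsJ, hc, Sum.elim_inr]; rfl
    rw [this, (h1 _).1, (h1 _).2, one_mul, mul_one, BalabanUVNodesPortS1.sl2Coord_chartMatJc]
    exact congrArg w (hp (Sum.inr a) (Prod.ext rfl hc)).symm

/-- (A4) ★★ **THE DERIVATIVE OF THE JOINT FLOW MAP AT THE ORIGIN**: `DΦ(0,0)(μ, v) = recordGradLeg μ + v` — the generator slot contributes the PURE-GAUGE LEG (the lattice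
gradient of `μ` on the `𝐔`-coordinates, ✓`hasDerivAt_gaugeFlowMap_expGauge`), the chart slot the identity (`Φ(0, ·) = id` near `0`).
[cite: Balaban1987RG1, (4.8) p.283 («− g⁻¹(i ad_B) ∂λ» at B = 0), (4.15) p.284, (1.10) p.262] -/
theorem hasFDerivAt_gaugeFlowMap₂_zero (K : ℕ) :
    ∃ L : ((Site (F.P K) 0 → Fin 3 → ℂ) × (Fin (recordChartDimJ F K) → ℂ)) →L[ℂ] (Fin (recordChartDimJ F K) → ℂ),
      HasFDerivAt (fun p : (Site (F.P K) 0 → Fin 3 → ℂ) × (Fin (recordChartDimJ F K) → ℂ) => gaugeFlowMap F K (expGauge F K p.1 1) p.2) L 0 ∧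
      ∀ μ v, L (μ, v) = recordGradLeg F K μ + v := by
  set Ψ : (Site (F.P K) 0 → Fin 3 → ℂ) × (Fin (recordChartDimJ F K) → ℂ) → (Fin (recordChartDimJ F K) → ℂ) :=
    fun p => gaugeFlowMap F K (expGauge F K p.1 1) p.2 with hΨ
  have hd : HasFDerivAt Ψ (fderiv ℂ Ψ 0) 0 := (analyticAt_gaugeFlowMap₂_zero F K).differentiableAt.hasFDerivAt
  refine ⟨fderiv ℂ Ψ 0, hd, fun μ v => ?_⟩
  -- the chart slot: `Ψ (0, ·) = id` near `0`
  have hu : ∀ b : PBond (F.P K) 0, ‖actU F K (expGauge F K 0 1) 0 b - 1‖ < 1 / 4 := fun b => by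
    rw [actU_expGauge_zeroPot_zero, sub_self, norm_zero]; norm_num
  have hev : (fun w : Fin (recordChartDimJ F K) → ℂ => Ψ (0, w)) =ᶠ[𝓝 0] id := by
    filter_upwards [eventually_actU_small F K _ hu] with w hw
    exact gaugeFlowMap_expGauge_zeroPot_self F K w fun b => (hw b).2
  have hinr : HasFDerivAt (fun w : Fin (recordChartDimJ F K) → ℂ => Ψ (0, w))
      ((fderiv ℂ Ψ 0).comp (ContinuousLinearMap.inr ℂ (Site (F.P K) 0 → Fin 3 → ℂ) (Fin (recordChartDimJ F K) → ℂ))) 0 := by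
    have h0 : (fun w : Fin (recordChartDimJ F K) → ℂ => ((0 : Site (F.P K) 0 → Fin 3 → ℂ), w)) 0 = 0 := rfl
    have hd' : HasFDerivAt Ψ (fderiv ℂ Ψ 0) ((fun w : Fin (recordChartDimJ F K) → ℂ => ((0 : Site (F.P K) 0 → Fin 3 → ℂ), w)) 0) := by
      rw [h0]; exact hd
    exact hd'.comp 0 ((hasFDerivAt_const (0 : Site (F.P K) 0 → Fin 3 → ℂ) 0).prodMk (hasFDerivAt_id 0))
  have hid : HasFDerivAt (id : (Fin (recordChartDimJ F K) → ℂ) → Fin (recordChartDimJ F K) → ℂ)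
      ((fderiv ℂ Ψ 0).comp (ContinuousLinearMap.inr ℂ (Site (F.P K) 0 → Fin 3 → ℂ) (Fin (recordChartDimJ F K) → ℂ))) 0 :=
    hinr.congr_of_eventuallyEq hev.symm
  have hLv : fderiv ℂ Ψ 0 (0, v) = v := by
    have heq := hid.unique (hasFDerivAt_id (0 : Fin (recordChartDimJ F K) → ℂ))
    simpa using congrArg (fun T => T v) heq
  -- the generator slot: the real curve `t ↦ (t•μ, 0)`
  have hℓ : HasDerivAt (fun t : ℝ => t • ((μ, 0) : (Site (F.P K) 0 → Fin 3 → ℂ) × (Fin (recordChartDimJ F K) → ℂ))) ((μ, 0) : _ × _) 0 :=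
    ((hasDerivAt_id (0 : ℝ)).smul_const _).congr_deriv (one_smul ℝ _)
  have hℓ0 : (fun t : ℝ => t • ((μ, 0) : (Site (F.P K) 0 → Fin 3 → ℂ) × (Fin (recordChartDimJ F K) → ℂ))) 0 = 0 := zero_smul ℝ _
  have hcurve : HasDerivAt (fun t : ℝ => Ψ (t • ((μ, 0) : (Site (F.P K) 0 → Fin 3 → ℂ) × (Fin (recordChartDimJ F K) → ℂ))))
      (((fderiv ℂ Ψ 0).restrictScalars ℝ) (μ, 0)) 0 :=
    (hd.restrictScalars ℝ).comp_hasDerivAt_of_eq 0 hℓ hℓ0.symm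
  have hcurve' : HasDerivAt (fun t : ℝ => Ψ (t • ((μ, 0) : (Site (F.P K) 0 → Fin 3 → ℂ) × (Fin (recordChartDimJ F K) → ℂ))))
      (recordGradLeg F K μ) 0 := by
    have hfun : (fun t : ℝ => Ψ (t • ((μ, 0) : (Site (F.P K) 0 → Fin 3 → ℂ) × (Fin (recordChartDimJ F K) → ℂ)))) =
        fun t : ℝ => gaugeFlowMap F K (expGauge F K μ t) 0 := by
      funext t
      simp only [hΨ, Prod.smul_mk, smul_zero, expGauge_smul_one]
    rw [hfun]
    exact hasDerivAt_gaugeFlowMap_expGauge F K μ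
  have hLμ : fderiv ℂ Ψ 0 (μ, 0) = recordGradLeg F K μ := by
    simpa using hcurve.unique hcurve'
  calc fderiv ℂ Ψ 0 (μ, v) = fderiv ℂ Ψ 0 ((μ, 0) + (0, v)) := by simp
    _ = recordGradLeg F K μ + v := by rw [map_add, hLμ, hLv]

/-- (A4) The `fderiv` form: `fderiv ℂ Φ 0 (μ, v) = recordGradLeg μ + v`. [cite: Balaban1987RG1, (4.8) p.283, (4.15) p.284] -/
theorem fderiv_gaugeFlowMap₂_zero_apply (K : ℕ) (μ : Site (F.P K) 0 → Fin 3 → ℂ) (v : Fin (recordChartDimJ F K) → ℂ) :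
    fderiv ℂ (fun p : (Site (F.P K) 0 → Fin 3 → ℂ) × (Fin (recordChartDimJ F K) → ℂ) => gaugeFlowMap F K (expGauge F K p.1 1) p.2) 0 (μ, v) =
      recordGradLeg F K μ + v := by
  obtain ⟨L, hL, hLv⟩ := hasFDerivAt_gaugeFlowMap₂_zero F K
  rw [hL.fderiv, hLv]

/-! ### (A5) The dressed-chart rows, generic in the base space `E`, the potential map `lamOf` and the chart `ι` -/

section Dressed

variable {E : Type*} [NormedAddCommGroup E] [NormedSpace ℝ E]

/-- (A5) ★★ **LINEARISATION OF A DRESSED CHART**: for an ℝ-linear potential map `lamOf` and a chart `ι` differentiable at `0` with `ι 0 = 0`, the dressed chart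
`B ↦ φ_{exp Λ_{lamOf B}}(ι B)` is differentiable at `0` with derivative `v ↦ recordGradLeg (lamOf v) + Dι(0) v`. [cite: Balaban1987RG1, (4.8) p.283, (4.15) p.284, (1.10) p.262] -/
theorem hasFDerivAt_dressed (K : ℕ) (lamOf : E →L[ℝ] (Site (F.P K) 0 → Fin 3 → ℂ)) {ι : E → Fin (recordChartDimJ F K) → ℂ}
    {ι' : E →L[ℝ] (Fin (recordChartDimJ F K) → ℂ)} (hι : HasFDerivAt ι ι' 0) (h0 : ι 0 = 0) :
    ∃ D : E →L[ℝ] (Fin (recordChartDimJ F K) → ℂ),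
      HasFDerivAt (fun e => gaugeFlowMap F K (expGauge F K (lamOf e) 1) (ι e)) D 0 ∧ ∀ v, D v = recordGradLeg F K (lamOf v) + ι' v := by
  obtain ⟨L, hL, hLv⟩ := hasFDerivAt_gaugeFlowMap₂_zero F K
  have hpair : HasFDerivAt (fun e => (lamOf e, ι e)) (lamOf.prod ι') 0 := lamOf.hasFDerivAt.prodMk hι
  have hpt : (fun e => (lamOf e, ι e)) 0 = 0 := by simp [h0]
  have hL' : HasFDerivAt (fun p : (Site (F.P K) 0 → Fin 3 → ℂ) × (Fin (recordChartDimJ F K) → ℂ) => gaugeFlowMap F K (expGauge F K p.1 1) p.2)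
      (L.restrictScalars ℝ) ((fun e => (lamOf e, ι e)) 0) := by
    rw [hpt]; exact hL.restrictScalars ℝ
  have hcomp := hL'.comp (0 : E) hpair
  refine ⟨(L.restrictScalars ℝ).comp (lamOf.prod ι'), hcomp, fun v => ?_⟩
  simp [hLv]

/-- (A5) `fderiv` form of the linearisation. [cite: Balaban1987RG1, (4.8) p.283, (4.15) p.284] -/
theorem fderiv_dressed_apply (K : ℕ) (lamOf : E →L[ℝ] (Site (F.P K) 0 → Fin 3 → ℂ)) {ι : E → Fin (recordChartDimJ F K) → ℂ}
    (hι : DifferentiableAt ℝ ι 0) (h0 : ι 0 = 0) (v : E) :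
    fderiv ℝ (fun e => gaugeFlowMap F K (expGauge F K (lamOf e) 1) (ι e)) 0 v = recordGradLeg F K (lamOf v) + fderiv ℝ ι 0 v := by
  obtain ⟨D, hD, hDv⟩ := hasFDerivAt_dressed F K lamOf hι.hasFDerivAt h0
  rw [hD.fderiv, hDv]

/-- (A5) ★ **SMOOTHNESS OF A DRESSED CHART**: `ContDiffAt ℝ n` at `0` is inherited from the chart `ι` (the joint flow map is analytic). [cite: Balaban1987RG1, (4.8) p.283] -/
theorem contDiffAt_dressed (K : ℕ) {n : WithTop ℕ∞} (lamOf : E →L[ℝ] (Site (F.P K) 0 → Fin 3 → ℂ)) {ι : E → Fin (recordChartDimJ F K) → ℂ}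
    (hι : ContDiffAt ℝ n ι 0) (h0 : ι 0 = 0) :
    ContDiffAt ℝ n (fun e => gaugeFlowMap F K (expGauge F K (lamOf e) 1) (ι e)) 0 := by
  have hC : ContDiffAt ℝ n (fun p : (Site (F.P K) 0 → Fin 3 → ℂ) × (Fin (recordChartDimJ F K) → ℂ) => gaugeFlowMap F K (expGauge F K p.1 1) p.2)
      ((fun e => (lamOf e, ι e)) 0) := by
    rw [show (fun e => (lamOf e, ι e)) 0 = 0 by simp [h0]]
    exact (analyticAt_gaugeFlowMap₂_zero F K).contDiffAt.restrict_scalars ℝ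
  have hcomp := hC.comp (0 : E) (lamOf.contDiff.contDiffAt.prodMk hι)
  exact hcomp

/-- (A5) Value row: a dressed chart vanishes at `0` when the chart does. [cite: Balaban1987RG1, (1.10) p.262 (bookkeeping)] -/
theorem dressed_zero (K : ℕ) (lamOf : E →L[ℝ] (Site (F.P K) 0 → Fin 3 → ℂ)) {ι : E → Fin (recordChartDimJ F K) → ℂ} (h0 : ι 0 = 0) :
    gaugeFlowMap F K (expGauge F K (lamOf 0) 1) (ι 0) = 0 := by
  rw [map_zero, h0, expGauge_zeroPot F K 1 0]
  exact gaugeFlowMap_expGauge_zero F K 0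

/-- (A5) Near `B = 0` every transformed `𝐔`-block of a dressed chart is within `½` of the unit (continuity; finitely many bonds). [cite: Balaban1987RG1, (4.8) p.283 (bookkeeping)] -/
theorem eventually_actU_dressed_lt (K : ℕ) (lamOf : E →L[ℝ] (Site (F.P K) 0 → Fin 3 → ℂ)) {ι : E → Fin (recordChartDimJ F K) → ℂ}
    (hι : ContinuousAt ι 0) (h0 : ι 0 = 0) :
    ∀ᶠ e in 𝓝 (0 : E), ∀ b : PBond (F.P K) 0, ‖actU F K (expGauge F K (lamOf e) 1) (ι e) b - 1‖ < 1 / 2 := by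
  refine eventually_all.2 fun b => ?_
  obtain ⟨Ls, hLs⟩ := exists_gaugeGenCLM F K b.src
  obtain ⟨Lt, hLt⟩ := exists_gaugeGenCLM F K b.tgt
  have hgs : Continuous fun e : E => gaugeGen F K (lamOf e) b.src := by
    have : (fun e : E => gaugeGen F K (lamOf e) b.src) = fun e => (Ls.restrictScalars ℝ) (lamOf e) := by funext e; simp [hLs]
    rw [this]; exact (Ls.restrictScalars ℝ).continuous.comp lamOf.continuous
  have hgt0 : Continuous fun e : E => gaugeGen F K (lamOf e) b.tgt := by
    have : (fun e : E => gaugeGen F K (lamOf e) b.tgt) = fun e => (Lt.restrictScalars ℝ) (lamOf e) := by funext e; simp [hLt]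
    rw [this]; exact (Lt.restrictScalars ℝ).continuous.comp lamOf.continuous
  have hgt : Continuous fun e : E => -gaugeGen F K (lamOf e) b.tgt := hgt0.neg
  have hm : ContinuousAt (fun e : E => exp (chartMatU F K (ι e) b)) 0 :=
    ContinuousAt.comp (g := fun w : Fin (recordChartDimJ F K) → ℂ => exp (chartMatU F K w b)) (f := ι) (x := 0)
      (continuous_mexp.comp (chartMatULM F K b).continuous_of_finiteDimensional).continuousAt hι
  have hc : ContinuousAt (fun e : E => actU F K (expGauge F K (lamOf e) 1) (ι e) b) 0 := by
    simp only [actU, coe_expGauge, coe_inv_expGauge, Complex.ofReal_one, one_smul]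
    exact ((continuous_mexp.comp hgs).continuousAt.mul hm).mul (continuous_mexp.comp hgt).continuousAt
  have h0v : actU F K (expGauge F K (lamOf 0) 1) (ι 0) b = 1 := by
    rw [map_zero, h0]; exact actU_expGauge_zeroPot_zero F K b
  have ht : Tendsto (fun e : E => ‖actU F K (expGauge F K (lamOf e) 1) (ι e) b - 1‖) (𝓝 0) (𝓝 0) := by
    have h1 : ContinuousAt (fun e : E => ‖actU F K (expGauge F K (lamOf e) 1) (ι e) b - 1‖) 0 := (hc.sub continuousAt_const).norm
    have h2 := h1.tendsto
    rw [h0v, sub_self, norm_zero] at h2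
    exact h2
  exact ht.eventually_lt_const (by norm_num)

/-- (A5) ★★ **THE SWAP ROW OF A DRESSED CHART**: near `B = 0`, on every piece-local coordinate, the dressed chart is the record gauge action of `g_B := exp Λ_{lamOf B}`
applied to the undressed chart — `χ_X(φ_{g_B}(ι B)) = (χ_X(ι B))^{g_B}`. [cite: Balaban1987RG1, (4.8) p.283, (1.7) p.261, (1.10) p.262] -/
theorem eventually_recordChartJ_dressed (Mc k K : ℕ) (lamOf : E →L[ℝ] (Site (F.P K) 0 → Fin 3 → ℂ)) {ι : E → Fin (recordChartDimJ F K) → ℂ}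
    (hι : ContinuousAt ι 0) (h0 : ι 0 = 0) :
    ∀ᶠ e in 𝓝 (0 : E), ∀ X : (recordDomSys F Mc k K).Dom, ∃ g : recordGaugeGrp F K, ∀ i ∈ recordCoords F Mc k K X,
      recordChartJ F Mc k K X (gaugeFlowMap F K (expGauge F K (lamOf e) 1) (ι e)) i = recordAct F K g (recordChartJ F Mc k K X (ι e)) i := by
  filter_upwards [eventually_actU_dressed_lt F K lamOf hι h0] with e he X
  exact ⟨expGauge F K (lamOf e) 1, recordChartJ_gaugeFlowMap F Mc k K X _ _ fun b _ => (he b).le⟩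

end Dressed

end Summit.QuantumFields.YangMills.Theorems.K0AxGaugeFlowRec

end
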